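import Mathlib
import Summits.Ventures.PercRepro2.HCov
import Summits.Ventures.PercRepro2.BHKAvoid
import Summits.Ventures.PercRepro2.ExploreA3
import Summits.Ventures.PercRepro2.RootLeafUSigns
import Summits.Ventures.PercRepro2.RootLeafUHalf
import Summits.Ventures.PercRepro2.RootLeafUOu
import Summits.Ventures.PercRepro2.RootLeafUTowerBHK

/-!
# The o-pocket `L` half, claim (i): `W·A ≥ 2β·P(R, bK)` for EVERY instance (blind cell PercRepro2, p4 g24;
S3 (G4-u), proofs/P4-G24-OPOCKETL-MASTER.md §3)

With the whole-instance masses of `T2oL` (RootLeafUHalf) — `D = P(PD)`, `t = P(T)`, `t′ = P(T′)`, `W = P(R) = D + t`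
(`R = {u ↮ a₂, u ↮ c} = PD ⊔ T`), `Z = P(Q) = D + t + t′`, `hb = P(a₂ ↔ b)`, `d0 = P(a₂ ↮ c)`, and the coefficients
`A = α + κ`, `β = D + d0·Z` of `T2oL` — the first whole-instance claim of the master identity
(S3 v88 (am) ADDENDUM) is a THEOREM for every finite graph and every weight vector:

  **`claim_i`**: `0 ≤ W·A − 2β·(P(PD, bK) + P(T, bK))`.

Proof (`claim_i_identity`, a `ring` identity after the splits `Q = PD ⊔ T ⊔ T′`, `R = PD ⊔ T`, `gap = P(Q, bK) − P(Q, bL)`):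

  `(i)/2 = (D − d0·W)(Z·hb − P(Q,bK)) + d0·Z·(W·hb − P(R,bK)) + t·(hb·t′ − P(T′,bK)) + (1 − d0)·W·P(T′,bL)
          + P(PD,bL)·((1 − d0)·W − t) + P(T,bL)·(D − d0·W) + (t·P(PD,bL) − D·P(T,bL))`,

seven products of nonnegative factors: Harris three times (`d0·W ≤ D` for the two decreasing events `{a₂ ↮ c}`, `R`;
`P(Q,bK) ≤ Z·hb`; `P(R,bK) ≤ W·hb`), the tower bound twice (`t ≤ P(a₂ ↔ c)·W` = `prob_T_le`; `P(T′, bK) ≤ hb·t′`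
= `TowerBHK.prob_clusterIn_inter_avoid_le_mul`: explore `C_u` on `{u ↮ a₂}`, `a₂ ↔ b` lives in `G ∖ C_u`) and BHK06
Thm 1.4 once (`D·P(T, bL) ≤ t·P(PD, bL)` = `ToL_mul_D_le` at `o := b`).  So the o-pocket route's claim (i) needs no
pocket structure at all.
-/

namespace Summit.Ventures.PercRepro2

open UnionCluster CovForm

namespace RootLeafU

namespace LMaster

variable {V : Type*} {E : Type*} [Fintype E] [DecidableEq E] [Fintype V] [DecidableEq V]
  {R : Type*} [Field R] [LinearOrder R] [IsStrictOrderedRing R]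

variable (p : E → R) (ends : E → Sym2 V) (a₂ c b u : V)

omit [Fintype E] [DecidableEq E] [Fintype V] [DecidableEq V] [LinearOrder R] [IsStrictOrderedRing R] in
/-- `{u ↔ c} ∩ {u ↮ a₂} = T′`. -/
lemma conn_inter_avoid_eq_Tp : connEvent ends u c ∩ avoidAll ends u {a₂} = TEvent ends a₂ u c := by
  ext ω
  simp only [Set.mem_inter_iff, mem_connEvent, mem_avoidAll, Finset.mem_singleton, forall_eq, TEvent,
    Set.mem_compl_iff]
  tauto

omit [Fintype E] [DecidableEq E] [Fintype V] [DecidableEq V] [LinearOrder R] [IsStrictOrderedRing R] in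
/-- `{u ↔ c} ∩ {a₂ ↔ b} ∩ {u ↮ a₂} = T′ ∩ {a₂ ↔ b}`. -/
lemma conn_inter_conn_inter_avoid_eq_Tp_bK :
    connEvent ends u c ∩ connEvent ends a₂ b ∩ avoidAll ends u {a₂} =
      TEvent ends a₂ u c ∩ connEvent ends a₂ b := by
  ext ω
  simp only [Set.mem_inter_iff, mem_connEvent, mem_avoidAll, Finset.mem_singleton, forall_eq, TEvent,
    Set.mem_compl_iff]
  tauto

omit [DecidableEq V] in
/-- **The tower bound for `T′`**: `P(T′, a₂ ↔ b) ≤ P(T′) · P(a₂ ↔ b)` (explore `C_u` on `{u ↮ a₂}`; given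
`C_u ∋ c`, the event `a₂ ↔ b` lives in `G ∖ C_u`). -/
lemma prob_Tp_bK_le (hp : IsProbVec p) :
    prob p (TEvent ends a₂ u c ∩ connEvent ends a₂ b) ≤ prob p (TEvent ends a₂ u c) * prob p (connEvent ends a₂ b) := by
  classical
  have h := TowerBHK.prob_clusterIn_inter_avoid_le_mul p ends u a₂ hp (X := {a₂})
    (Finset.mem_singleton_self a₂) {W : Set V | c ∈ W} (isUpperSet_mem_setOf b)
  rw [← connEvent_eq_clusterInEvent ends u c, ← connEvent_eq_clusterInEvent ends a₂ b,
    conn_inter_conn_inter_avoid_eq_Tp_bK, conn_inter_avoid_eq_Tp] at h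
  exact h

omit [Fintype V] in
/-- **The certificate identity of claim (i)**: `W·A − 2β·P(R, bK)` is twice the sum of seven products. -/
theorem claim_i_identity :
    (prob p (PDEvent ends u a₂ c) + prob p (TEvent ends u a₂ c)) * ((prob p (PDEvent ends u a₂ c) * prob p (connEvent ends a₂ b) + prob p (avoidAll ends a₂ {c}) * gap p ends u a₂ b) + (prob p Set.univ * EQb3 p ends u a₂ c b + prob p Set.univ * PDb p ends u a₂ c b + prob p (connEvent ends a₂ b) * EQ3 p ends u a₂ c + prob p (connEvent ends a₂ b) * prob p (avoidAll ends a₂ {u}) - (prob p Set.univ - prob p (avoidAll ends a₂ {c})) * gap p ends u a₂ b)) - 2 * (prob p Set.univ * prob p (PDEvent ends u a₂ c) + prob p (avoidAll ends a₂ {c}) * prob p (avoidAll ends a₂ {u})) * (prob p (PDEvent ends u a₂ c ∩ connEvent ends a₂ b) + prob p (TEvent ends u a₂ c ∩ connEvent ends a₂ b)) =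
      2 * ((prob p (PDEvent ends u a₂ c) - prob p (avoidAll ends a₂ {c}) * (prob p (PDEvent ends u a₂ c) + prob p (TEvent ends u a₂ c))) * ((prob p (PDEvent ends u a₂ c) + prob p (TEvent ends u a₂ c) + prob p (TEvent ends a₂ u c)) * prob p (connEvent ends a₂ b) - (prob p (PDEvent ends u a₂ c ∩ connEvent ends a₂ b) + prob p (TEvent ends u a₂ c ∩ connEvent ends a₂ b) + prob p (TEvent ends a₂ u c ∩ connEvent ends a₂ b))) + prob p (avoidAll ends a₂ {c}) * (prob p (PDEvent ends u a₂ c) + prob p (TEvent ends u a₂ c) + prob p (TEvent ends a₂ u c)) * ((prob p (PDEvent ends u a₂ c) + prob p (TEvent ends u a₂ c)) * prob p (connEvent ends a₂ b) - (prob p (PDEvent ends u a₂ c ∩ connEvent ends a₂ b) + prob p (TEvent ends u a₂ c ∩ connEvent ends a₂ b))) + prob p (TEvent ends u a₂ c) * (prob p (connEvent ends a₂ b) * prob p (TEvent ends a₂ u c) - prob p (TEvent ends a₂ u c ∩ connEvent ends a₂ b)) + (1 - prob p (avoidAll ends a₂ {c})) * (prob p (PDEvent ends u a₂ c) + prob p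 (TEvent ends u a₂ c)) * prob p (TEvent ends a₂ u c ∩ connEvent ends u b) + prob p (PDEvent ends u a₂ c ∩ connEvent ends u b) * ((1 - prob p (avoidAll ends a₂ {c})) * (prob p (PDEvent ends u a₂ c) + prob p (TEvent ends u a₂ c)) - prob p (TEvent ends u a₂ c)) + prob p (TEvent ends u a₂ c ∩ connEvent ends u b) * (prob p (PDEvent ends u a₂ c) - prob p (avoidAll ends a₂ {c}) * (prob p (PDEvent ends u a₂ c) + prob p (TEvent ends u a₂ c))) + prob p (PDEvent ends u a₂ c ∩ connEvent ends u b) * prob p (TEvent ends u a₂ c) - prob p (TEvent ends u a₂ c ∩ connEvent ends u b) * prob p (PDEvent ends u a₂ c)) := by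
  have hZ := Qsplit_univ p ends u a₂ c
  have hbK := Qsplit p ends u a₂ c (connEvent ends a₂ b)
  have hbL := Qsplit p ends u a₂ c (connEvent ends u b)
  have hgap := gap_eq_Q p ends u a₂ b
  unfold EQb3 PDb EQ3
  rw [hgap, hZ, hbK, hbL, prob_univ]
  ring

/-- **Claim (i) for every instance**: `0 ≤ W·A − 2β·P(R, bK)`. -/
theorem claim_i (hp : IsProbVec p) :
    0 ≤ (prob p (PDEvent ends u a₂ c) + prob p (TEvent ends u a₂ c)) * ((prob p (PDEvent ends u a₂ c) * prob p (connEvent ends a₂ b) + prob p (avoidAll ends a₂ {c}) * gap p ends u a₂ b) + (prob p Set.univ * EQb3 p ends u a₂ c b + prob p Set.univ * PDb p ends u a₂ c b + prob p (connEvent ends a₂ b) * EQ3 p ends u a₂ c + prob p (connEvent ends a₂ b) * prob p (avoidAll ends a₂ {u}) - (prob p Set.univ - prob p (avoidAll ends a₂ {c})) * gap p ends u a₂ b)) - 2 * (prob p Set.univ * prob p (PDEvent ends u a₂ c) + prob p (avoidAll ends a₂ {c}) * prob p (avoidAll ends a₂ {u})) * (prob p (PDEvent ends u a₂ c ∩ connEvent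 ends a₂ b) + prob p (TEvent ends u a₂ c ∩ connEvent ends a₂ b)) := by
  classical
  rw [claim_i_identity]
  have hR : prob p (PDEvent ends u a₂ c) + prob p (TEvent ends u a₂ c) = prob p (avoidAll ends u {a₂, c}) := by
    have h := ISplit.prob_PD_add_T p ends u a₂ c Set.univ
    simpa only [Set.inter_univ] using h
  have hRbK := ISplit.prob_PD_add_T p ends u a₂ c (connEvent ends a₂ b)
  have hZ := Qsplit_univ p ends u a₂ c
  have hbK := Qsplit p ends u a₂ c (connEvent ends a₂ b)
  have hd0 : prob p (avoidAll ends a₂ {c}) = 1 - prob p (connEvent ends a₂ c) := by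
    rw [avoidAll_singleton_eq, prob_compl]
  have hQ : IsLowerSet (avoidAll ends a₂ {u}) := isLowerSet_avoidAll_finset ends a₂ {u}
  have hRl : IsLowerSet (avoidAll ends u {a₂, c}) := isLowerSet_avoidAll_finset ends u {a₂, c}
  have hcl : IsLowerSet (avoidAll ends a₂ {c}) := isLowerSet_avoidAll_finset ends a₂ {c}
  -- (H1) `P(Q, bK) ≤ Z·hb`
  have H1 := prob_inter_le_prob_mul_prob_of_isLowerSet hp hQ (isUpperSet_connEvent ends a₂ b)
  -- (H3) `P(R, bK) ≤ W·hb`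
  have H3 := prob_inter_le_prob_mul_prob_of_isLowerSet hp hRl (isUpperSet_connEvent ends a₂ b)
  -- (H2) `d0·W ≤ P(a₂ ↮ c, R) = D`
  have H2 := prob_mul_prob_le_prob_inter_of_isLowerSet hp hcl hRl
  have hPD : prob p (avoidAll ends a₂ {c} ∩ avoidAll ends u {a₂, c}) = prob p (PDEvent ends u a₂ c) := by
    have h := prob_inter_add_prob_inter_compl p (avoidAll ends u {a₂, c}) (connEvent ends a₂ c)
    have e1 : avoidAll ends u {a₂, c} ∩ connEvent ends a₂ c = TEvent ends u a₂ c := by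
      rw [Set.inter_comm, conn_inter_R]
    have e2 : avoidAll ends a₂ {c} ∩ avoidAll ends u {a₂, c} =
        avoidAll ends u {a₂, c} ∩ (connEvent ends a₂ c)ᶜ := by
      rw [avoidAll_singleton_eq, Set.inter_comm]
    rw [e1] at h
    rw [e2]
    linarith
  rw [hPD] at H2
  -- (H5) `t ≤ P(a₂ ↔ c)·W`
  have H5 := prob_T_le p ends a₂ c u hp
  -- (H6) BHK06 1.4 at `o := b`: `D·P(T, bL) ≤ t·P(PD, bL)`
  have H6 := ToL_mul_D_le p hp ends b u a₂ c
  -- (H7) the tower bound for `T′`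
  have H7 := prob_Tp_bK_le p ends a₂ c b u hp
  have hc' : prob p (connEvent ends a₂ c) = 1 - prob p (avoidAll ends a₂ {c}) := by linarith
  rw [hc'] at H5
  rw [← hR] at H2 H3 H5
  rw [hZ, hbK] at H1
  rw [← hRbK] at H3
  have n_d0 := prob_nonneg hp (avoidAll ends a₂ {c})
  have n_D := prob_nonneg hp (PDEvent ends u a₂ c)
  have n_t := prob_nonneg hp (TEvent ends u a₂ c)
  have n_tp := prob_nonneg hp (TEvent ends a₂ u c)
  have n_PDbL := prob_nonneg hp (PDEvent ends u a₂ c ∩ connEvent ends u b)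
  have n_TbL := prob_nonneg hp (TEvent ends u a₂ c ∩ connEvent ends u b)
  have n_TpbL := prob_nonneg hp (TEvent ends a₂ u c ∩ connEvent ends u b)
  have n_1d0 : 0 ≤ 1 - prob p (avoidAll ends a₂ {c}) := by linarith [prob_le_one hp (avoidAll ends a₂ {c})]
  have g1 : 0 ≤ (prob p (PDEvent ends u a₂ c) - prob p (avoidAll ends a₂ {c}) * (prob p (PDEvent ends u a₂ c) + prob p (TEvent ends u a₂ c))) * ((prob p (PDEvent ends u a₂ c) + prob p (TEvent ends u a₂ c) + prob p (TEvent ends a₂ u c)) * prob p (connEvent ends a₂ b) - (prob p (PDEvent ends u a₂ c ∩ connEvent ends a₂ b) + prob p (TEvent ends u a₂ c ∩ connEvent ends a₂ b) + prob p (TEvent ends a₂ u c ∩ connEvent ends a₂ b))) := mul_nonneg (by linarith) (by linarith)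
  have g2 : 0 ≤ prob p (avoidAll ends a₂ {c}) * (prob p (PDEvent ends u a₂ c) + prob p (TEvent ends u a₂ c) + prob p (TEvent ends a₂ u c)) * ((prob p (PDEvent ends u a₂ c) + prob p (TEvent ends u a₂ c)) * prob p (connEvent ends a₂ b) - (prob p (PDEvent ends u a₂ c ∩ connEvent ends a₂ b) + prob p (TEvent ends u a₂ c ∩ connEvent ends a₂ b))) := mul_nonneg (mul_nonneg n_d0 (by linarith)) (by linarith)
  have g4 : 0 ≤ prob p (TEvent ends u a₂ c) * (prob p (connEvent ends a₂ b) * prob p (TEvent ends a₂ u c) - prob p (TEvent ends a₂ u c ∩ connEvent ends a₂ b)) := mul_nonneg n_t (by linarith)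
  have g5 : 0 ≤ (1 - prob p (avoidAll ends a₂ {c})) * (prob p (PDEvent ends u a₂ c) + prob p (TEvent ends u a₂ c)) * prob p (TEvent ends a₂ u c ∩ connEvent ends u b) := mul_nonneg (mul_nonneg n_1d0 (by linarith)) n_TpbL
  have g6 : 0 ≤ prob p (PDEvent ends u a₂ c ∩ connEvent ends u b) * ((1 - prob p (avoidAll ends a₂ {c})) * (prob p (PDEvent ends u a₂ c) + prob p (TEvent ends u a₂ c)) - prob p (TEvent ends u a₂ c)) := mul_nonneg n_PDbL (by linarith)
  have g7 : 0 ≤ prob p (TEvent ends u a₂ c ∩ connEvent ends u b) * (prob p (PDEvent ends u a₂ c) - prob p (avoidAll ends a₂ {c}) * (prob p (PDEvent ends u a₂ c) + prob p (TEvent ends u a₂ c))) := mul_nonneg n_TbL (by linarith)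
  have g8 : 0 ≤ prob p (PDEvent ends u a₂ c ∩ connEvent ends u b) * prob p (TEvent ends u a₂ c) - prob p (TEvent ends u a₂ c ∩ connEvent ends u b) * prob p (PDEvent ends u a₂ c) := by linarith
  linarith

end LMaster

end RootLeafU

end Summit.Ventures.PercRepro2
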